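import Literature.AlgebraicGeometry.Motives.HodgeStructureAutGroupHodgeLefschetzGroups
import Mathlib.LinearAlgebra.Eigenspace.Minpoly
import HarnessLib

/-!
# `E_φ` is spanned by `Aut(V, φ) = E_φ^×`; hence the commutant of `Aut(V, φ)` is Milne's `C(H)`, `S(H)(ℚ) = Z_{Aut(V,Q)}(Aut(V, φ))(ℚ)` («the largest subgroup of `Sp(e_D)`
# whose elements commute with the endomorphisms»), `Aut(V, φ)` and `S(H)(ℚ)` are mutual commutants relative to `G(ℚ)`, the centre of `Aut(V, φ)` is `Z(E_φ)^×`, a Hodge isometry lies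
# in `S(H)(ℚ)` iff it is central in `Aut(V, φ)`, `Aut(V, φ)` is abelian iff `E_φ` is commutative, and the `Aut(V, φ)`-stable subspaces are the `E_φ`-submodules
# (Milne 1999 §1 p. 644, Remark 1.2, §3 p. 653; Green–Griffiths–Kerr (V.2))

[topic AlgebraicGeometry/Motives]

Layer `Literature/AlgebraicGeometry/Motives`, lane `lit-hodgefound` (Track 2 foundations library; seat `lit-hodgefound-p02`, gen 44, row g44-#8). THEOREMS ONLY; no definition,
no named fact (D-0026 net debt `0`), no instance, no notation. Sequel of g44-#1/#6 (`Motives/HodgeStructurePolarizationAutGroup`, `Motives/HodgeStructureAutGroupHodgeLefschetzGroups`: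
`H.autGroup = Aut(V, φ) = E_φ^×`, `ψ.isometryGroup = G(ℚ)`, `ψ.autGroup = Aut(V, Q, φ)(ℚ)`, `ψ.lefschetzGroup = S(H)(ℚ)`, `Aut(V, φ) = Z_{GL(V)}(S(H)(ℚ))`). The one new input is
elementary: an endomorphism of a finite-dimensional `ℚ`-space has finitely many eigenvalues (Mathlib's `Module.End.finite_spectrum`), so for `a ∈ E_φ` some `c·1 − a` (`c ∈ ℚ`) is
invertible, i.e. lies in `E_φ^× = Aut(V, φ)`; thus `E_φ = ℚ·1 + Aut(V, φ)` is spanned by its units and «commutes with the endomorphisms» ⟺ «commutes with the automorphisms».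

## The sources, verbatim

* J. S. Milne, *Lefschetz classes on abelian varieties*, Duke Math. J. **96** (1999) [Milne1999LefschetzClasses] (held `paper:doi-10-1215-s0012-7094-99-09620-5`), §1 p0006
  L16–L20 (p. 644): «we define `S(A)` to be the algebraic subgroup of `GL(V(A))` such that, for all commutative `k`-algebras `R`, `S(A)(R) = {γ ∈ C(A) ⊗_k R | γ†γ = 1}`. Thus,
  for any ample divisor `D` on `A`, `S(A)` is the largest algebraic subgroup of `Sp(e_D)` whose elements commute with the endomorphisms of `A`.»; p0004 L75–L77 (p. 642): «we define
  `C(A)` to be the centralizer of `End⁰(A)` in `End_k(V(A))`»; §1 Remark 1.2 (p0005 L32–L33, p. 643): «the centralizer of `C(A)` in `End_k(V(A))` is `End⁰(A) ⊗_ℚ k`»; §3 p. 653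
  L44–L45: «the `k`-algebra `C(A)` is generated by the `γ ∈ S(A)(k)`» — here the companion statement on the other side: `E_φ` is generated (indeed spanned) by `Aut(V, φ)`.
* M. Green, P. Griffiths, M. Kerr, *Mumford–Tate Groups and Domains* [GreenGriffithsKerr2012], (V.2) proof (held p0152 L5–L6): «`E* := E∖{0} ⊂ G̃(ℚ)`; in fact, `E*` is just the
  `ℚ`-points of the centralizer `Z := Z_{G̃}(M)`» — in the simple case ALL of `E∖{0}` consists of automorphisms; in general `E = ℚ·1 + E^×`.

## What is proved (`V` finite-dimensional over `ℚ`, `H : HodgeStructure V n`, `ψ : Polarization H`)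

* §1 **`exists_mem_autGroup_eq_algebraMap_sub`** (`a ∈ E_φ ⟹ a = c·1 − g`, `g ∈ Aut(V, φ)`), **`span_image_coe_autGroup_eq`** (`ℚ·Aut(V, φ) = E_φ`), `adjoin_image_coe_autGroup_eq`,
  **`forall_autGroup_comm_iff_mem_centralizer_endAlg`** / `centralizer_image_coe_autGroup_eq` (the commutant of `Aut(V, φ)` is `C(H)`), `forall_autGroup_map_le_iff_forall_endAlg_map_le`
  (`Aut`-stable subspaces = `E_φ`-submodules), **`autGroup_comm_iff_endAlg_comm`** (`Aut(V, φ)` abelian ⟺ `E_φ` commutative), **`mem_center_autGroup_iff`**,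
  `mem_center_autGroup_iff_mem_center_endAlg` (`Z(Aut(V, φ)) = Z(E_φ)^×`).
* §2 **`Polarization.lefschetzGroup_eq_centralizer_autGroup_inf_isometryGroup`** (`S(H)(ℚ) = Z_{G(ℚ)}(Aut(V, φ))`), `Polarization.mem_lefschetzGroup_iff_forall_autGroup_comm`,
  **`Polarization.coe_mem_lefschetzGroup_iff_mem_center`** (a Hodge isometry lies in `S(H)(ℚ)` iff it is central in `Aut(V, φ)`), `Polarization.autGroup_le_lefschetzGroup_iff`
  (`Aut(V, Q, φ) ≤ S(H)(ℚ)` iff `Aut(V, Q, φ)` is central in `Aut(V, φ)`); with the Hodge group (`[HodgeTensorFacts]`, g44-#6's `Aut(V, φ) = Z_{GL(V)}(S(H)(ℚ))`):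
  **`Polarization.centralizer_centralizer_autGroup_inf_isometryGroup_eq`** (`Z_{GL(V)}(Z_{G(ℚ)}(Aut(V, φ))) = Aut(V, φ)`), `Polarization.centralizer_centralizer_lefschetzGroup_inf_isometryGroup_eq`
  (`Z_{G(ℚ)}(Z_{GL(V)}(S(H)(ℚ))) = S(H)(ℚ)`).

## References

* [Milne1999LefschetzClasses] J. S. Milne, Lefschetz classes on abelian varieties, Duke Math. J. 96 (1999) 639–675: §1 pp. 642–644 (C(A), Remark 1.2, S(A)); §3 p. 653 L44–L45.
* [GreenGriffithsKerr2012] M. Green, P. Griffiths, M. Kerr, *Mumford–Tate Groups and Domains*, Ann. of Math. Stud. 183 (2012): (V.2) proof (PDF p. 152).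
-/

open Module
open scoped TensorProduct

namespace Literature.AlgebraicGeometry.Motives

namespace HodgeStructure

universe u

variable {V : Type u} [AddCommGroup V] [Module ℚ V] [Module.Finite ℚ V] {n : ℤ}

/-- Off the (finite) spectrum, `c·1 − a` is invertible (plumbing; Mathlib's `Module.End.finite_spectrum`). [folklore] -/
private theorem exists_rat_isUnit_algebraMap_sub₈ (a : Module.End ℚ V) : ∃ c : ℚ, IsUnit (algebraMap ℚ (Module.End ℚ V) c - a) := by
  obtain ⟨c, -, hc⟩ := Set.infinite_univ.exists_notMem_finite (Module.End.finite_spectrum a)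
  exact ⟨c, spectrum.notMem_iff.1 hc⟩

omit [Module.Finite ℚ V] in
/-- `↑(g g') = ↑g ↑g'` read backwards for a commutation relation (plumbing). [folklore] -/
private theorem coe_mul_eq_coe_mul_of_mul_eq₈ {g g' : V ≃ₗ[ℚ] V} (h : g * g' = g' * g) :
    (g : Module.End ℚ V) * (g' : Module.End ℚ V) = (g' : Module.End ℚ V) * (g : Module.End ℚ V) := by
  rw [← LinearEquiv.coe_toLinearMap_mul, ← LinearEquiv.coe_toLinearMap_mul, h]

omit [Module.Finite ℚ V] in
/-- The converse plumbing: `↑g ↑g' = ↑g' ↑g ⟹ g g' = g' g`. [folklore] -/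
private theorem mul_eq_mul_of_coe_mul_eq₈ {g g' : V ≃ₗ[ℚ] V} (h : (g : Module.End ℚ V) * (g' : Module.End ℚ V) = (g' : Module.End ℚ V) * (g : Module.End ℚ V)) :
    g * g' = g' * g :=
  LinearEquiv.toLinearMap_injective (by rw [LinearEquiv.coe_toLinearMap_mul, LinearEquiv.coe_toLinearMap_mul, h])

/-! ## §1 `E_φ = ℚ·1 + Aut(V, φ)`: span, commutant, stable subspaces, commutativity, centre -/

section Span

variable (H : HodgeStructure V n)

/-- **Every Hodge endomorphism is a rational scalar minus a Hodge automorphism**: for `a ∈ E_φ` there are `c ∈ ℚ` and `g ∈ Aut(V, φ) = E_φ^×` with `↑g = c·1 − a` (`c` off the finite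
spectrum of `a`). [cite: GreenGriffithsKerr2012, (V.2) proof (PDF p. 152, «E* ⊂ G̃(ℚ)»)] [cite: Milne1999LefschetzClasses, §3 p. 653 L44–L45] -/
theorem exists_mem_autGroup_eq_algebraMap_sub {a : Module.End ℚ V} (ha : a ∈ H.endAlg) :
    ∃ c : ℚ, ∃ g ∈ H.autGroup, (g : Module.End ℚ V) = algebraMap ℚ (Module.End ℚ V) c - a := by
  obtain ⟨c, hc⟩ := exists_rat_isUnit_algebraMap_sub₈ a
  have hbij : Function.Bijective (algebraMap ℚ (Module.End ℚ V) c - a) := (Module.End.isUnit_iff _).1 hc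
  exact ⟨c, LinearEquiv.ofBijective _ hbij, H.endAlg.sub_mem (H.endAlg.algebraMap_mem c) ha, LinearMap.ext fun _ ↦ rfl⟩

/-- **`E_φ` is the `ℚ`-span of `Aut(V, φ)`** (the endomorphism algebra is spanned by its unit group; companion of «`C(A)` is generated by the `γ ∈ S(A)(k)`»).
[cite: Milne1999LefschetzClasses, §3 p. 653 L44–L45] [cite: GreenGriffithsKerr2012, (V.2) proof (PDF p. 152)] -/
theorem span_image_coe_autGroup_eq :
    Submodule.span ℚ ((fun g : V ≃ₗ[ℚ] V ↦ (g : Module.End ℚ V)) '' (H.autGroup : Set (V ≃ₗ[ℚ] V))) = Subalgebra.toSubmodule H.endAlg := by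
  refine le_antisymm (Submodule.span_le.2 ?_) fun a ha ↦ ?_
  · rintro _ ⟨g, hg, rfl⟩
    exact hg
  · obtain ⟨c, g, hg, hcg⟩ := H.exists_mem_autGroup_eq_algebraMap_sub ha
    have ha' : a = algebraMap ℚ (Module.End ℚ V) c - (g : Module.End ℚ V) := by rw [hcg, sub_sub_cancel]
    rw [ha', Algebra.algebraMap_eq_smul_one]
    exact Submodule.sub_mem _ (Submodule.smul_mem _ c (Submodule.subset_span ⟨1, H.autGroup.one_mem, rfl⟩)) (Submodule.subset_span ⟨g, hg, rfl⟩)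

/-- **`E_φ = ℚ[Aut(V, φ)]`** as `ℚ`-algebras. [cite: Milne1999LefschetzClasses, §3 p. 653 L44–L45] -/
theorem adjoin_image_coe_autGroup_eq :
    Algebra.adjoin ℚ ((fun g : V ≃ₗ[ℚ] V ↦ (g : Module.End ℚ V)) '' (H.autGroup : Set (V ≃ₗ[ℚ] V))) = H.endAlg := by
  refine le_antisymm (Algebra.adjoin_le ?_) fun a ha ↦ ?_
  · rintro _ ⟨g, hg, rfl⟩
    exact hg
  · have ha' : a ∈ Submodule.span ℚ ((fun g : V ≃ₗ[ℚ] V ↦ (g : Module.End ℚ V)) '' (H.autGroup : Set (V ≃ₗ[ℚ] V))) := by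
      rw [span_image_coe_autGroup_eq]
      exact ha
    exact Algebra.span_le_adjoin ℚ _ ha'

/-- **The commutant of `Aut(V, φ)` in `End_ℚ(V)` is Milne's `C(H) = End_{E_φ}(V)`**: `c` commutes with every Hodge automorphism iff it commutes with every Hodge endomorphism.
[cite: Milne1999LefschetzClasses, §1 p. 642 L75–L77 (C(A)) and p. 644 L16–L20] -/
theorem forall_autGroup_comm_iff_mem_centralizer_endAlg (c : Module.End ℚ V) :
    (∀ g ∈ H.autGroup, c * (g : Module.End ℚ V) = (g : Module.End ℚ V) * c) ↔ c ∈ Subalgebra.centralizer ℚ (H.endAlg : Set (Module.End ℚ V)) := by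
  rw [Subalgebra.mem_centralizer_iff]
  constructor
  · intro h a ha
    obtain ⟨q, g, hg, hqg⟩ := H.exists_mem_autGroup_eq_algebraMap_sub ha
    have h1 := h g hg
    rw [hqg, mul_sub, sub_mul, Algebra.commutes, sub_right_inj] at h1
    exact h1.symm
  · intro h g hg
    exact (h _ hg).symm

/-- `Z_{End(V)}(Aut(V, φ)) = C(H)` as subalgebras. [cite: Milne1999LefschetzClasses, §1 p. 642 L75–L77 and p. 644 L16–L20] -/
theorem centralizer_image_coe_autGroup_eq :
    Subalgebra.centralizer ℚ ((fun g : V ≃ₗ[ℚ] V ↦ (g : Module.End ℚ V)) '' (H.autGroup : Set (V ≃ₗ[ℚ] V))) =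
      Subalgebra.centralizer ℚ (H.endAlg : Set (Module.End ℚ V)) := by
  refine Subalgebra.ext fun c ↦ ?_
  rw [← H.forall_autGroup_comm_iff_mem_centralizer_endAlg, Subalgebra.mem_centralizer_iff]
  constructor
  · intro h g hg
    exact (h _ ⟨g, hg, rfl⟩).symm
  · rintro h _ ⟨g, hg, rfl⟩
    exact (h g hg).symm

/-- **The `Aut(V, φ)`-stable rational subspaces are exactly the `E_φ`-submodules.** [cite: Milne1999LefschetzClasses, §1 p. 642 L75–L77 and §3 p. 653 L44–L45] -/
theorem forall_autGroup_map_le_iff_forall_endAlg_map_le (W : Submodule ℚ V) :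
    (∀ g ∈ H.autGroup, W.map (g : V →ₗ[ℚ] V) ≤ W) ↔ ∀ a ∈ H.endAlg, W.map a ≤ W := by
  constructor
  · intro h a ha
    obtain ⟨c, g, hg, hcg⟩ := H.exists_mem_autGroup_eq_algebraMap_sub ha
    have ha' : a = algebraMap ℚ (Module.End ℚ V) c - (g : Module.End ℚ V) := by rw [hcg, sub_sub_cancel]
    rintro _ ⟨w, hw, rfl⟩
    rw [ha', LinearMap.sub_apply, Module.algebraMap_end_apply]
    exact W.sub_mem (W.smul_mem c hw) (h g hg ⟨w, hw, rfl⟩)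
  · intro h g hg
    exact h _ hg

/-- **`Aut(V, φ)` is abelian iff `E_φ` is commutative.** [cite: GreenGriffithsKerr2012, (V.2) proof (PDF p. 152)] [cite: Milne1999LefschetzClasses, §3 p. 653 L44–L45] -/
theorem autGroup_comm_iff_endAlg_comm :
    (∀ g ∈ H.autGroup, ∀ g' ∈ H.autGroup, g * g' = g' * g) ↔ ∀ a ∈ H.endAlg, ∀ b ∈ H.endAlg, a * b = b * a := by
  constructor
  · intro h a ha b hb
    have hb' : b ∈ Subalgebra.centralizer ℚ (H.endAlg : Set (Module.End ℚ V)) := by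
      refine (H.forall_autGroup_comm_iff_mem_centralizer_endAlg b).1 fun g hg ↦ ?_
      obtain ⟨c, u, hu, hcu⟩ := H.exists_mem_autGroup_eq_algebraMap_sub hb
      have hb'' : b = algebraMap ℚ (Module.End ℚ V) c - (u : Module.End ℚ V) := by rw [hcu, sub_sub_cancel]
      rw [hb'', sub_mul, mul_sub, coe_mul_eq_coe_mul_of_mul_eq₈ (h u hu g hg), Algebra.commutes]
    exact (Subalgebra.mem_centralizer_iff ℚ).1 hb' a ha
  · intro h g hg g' hg'
    exact mul_eq_mul_of_coe_mul_eq₈ (h _ hg _ hg')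

/-- **The centre of `Aut(V, φ)` consists of the Hodge automorphisms central in `E_φ`** (`Z(E_φ^×) = Z(E_φ)^×`, as `E_φ` is spanned by its units).
[cite: GreenGriffithsKerr2012, (V.2) proof (PDF p. 152)] [cite: Milne1999LefschetzClasses, §1 Remark 1.2 (p. 643)] -/
theorem mem_center_autGroup_iff (g : H.autGroup) :
    g ∈ Subgroup.center H.autGroup ↔ ∀ a ∈ H.endAlg, a * ((g : V ≃ₗ[ℚ] V) : Module.End ℚ V) = ((g : V ≃ₗ[ℚ] V) : Module.End ℚ V) * a := by
  rw [Subgroup.mem_center_iff]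
  constructor
  · intro hg a ha
    obtain ⟨c, u, hu, hcu⟩ := H.exists_mem_autGroup_eq_algebraMap_sub ha
    have ha' : a = algebraMap ℚ (Module.End ℚ V) c - (u : Module.End ℚ V) := by rw [hcu, sub_sub_cancel]
    have hc : (u : Module.End ℚ V) * ((g : V ≃ₗ[ℚ] V) : Module.End ℚ V) = ((g : V ≃ₗ[ℚ] V) : Module.End ℚ V) * (u : Module.End ℚ V) :=
      coe_mul_eq_coe_mul_of_mul_eq₈ (congrArg Subtype.val (hg ⟨u, hu⟩))
    rw [ha', sub_mul, mul_sub, hc, Algebra.commutes]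
  · intro h u
    exact Subtype.ext (mul_eq_mul_of_coe_mul_eq₈ (h _ u.2))

/-- `Z(Aut(V, φ)) = Z(E_φ)^×`: `g` is central in `Aut(V, φ)` iff `↑g` is central in `E_φ`. [cite: GreenGriffithsKerr2012, (V.2) proof (PDF p. 152)] [cite: Milne1999LefschetzClasses, §1 Remark 1.2 (p. 643)] -/
theorem mem_center_autGroup_iff_mem_center_endAlg (g : H.autGroup) :
    g ∈ Subgroup.center H.autGroup ↔ (⟨((g : V ≃ₗ[ℚ] V) : Module.End ℚ V), g.2⟩ : H.endAlg) ∈ Subalgebra.center ℚ H.endAlg := by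
  rw [mem_center_autGroup_iff, Subalgebra.mem_center_iff]
  constructor
  · intro h a
    apply Subtype.ext
    rw [Subalgebra.coe_mul, Subalgebra.coe_mul]
    exact h a a.2
  · intro h a ha
    have h1 := congrArg Subtype.val (h ⟨a, ha⟩)
    rw [Subalgebra.coe_mul, Subalgebra.coe_mul] at h1
    exact h1

end Span

/-! ## §2 Polarized: `S(H)(ℚ) = Z_{G(ℚ)}(Aut(V, φ))`; a Hodge isometry is in `S(H)(ℚ)` iff central in `Aut(V, φ)`; bicommutants relative to `G(ℚ)` -/

section Polarized

variable {H : HodgeStructure V n} (ψ : Polarization H)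

/-- **Milne's `S(H)(ℚ)` is the centralizer of `Aut(V, φ)` in `G(ℚ) = Aut(V, Q)(ℚ)`**: «the largest algebraic subgroup of `Sp(e_D)` whose elements commute with the endomorphisms» —
equivalently with the automorphisms, which span `E_φ`. [cite: Milne1999LefschetzClasses, §1 p. 644 L16–L20] -/
theorem Polarization.lefschetzGroup_eq_centralizer_autGroup_inf_isometryGroup :
    ψ.lefschetzGroup = Subgroup.centralizer (H.autGroup : Set (V ≃ₗ[ℚ] V)) ⊓ ψ.isometryGroup := by
  ext g
  rw [Subgroup.mem_inf, Subgroup.mem_centralizer_iff, Polarization.mem_lefschetzGroup_iff, forall_endAlg_apply_iff_coe_mem_centralizer_endAlg H,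
    ← H.forall_autGroup_comm_iff_mem_centralizer_endAlg, Polarization.mem_isometryGroup_iff]
  exact and_congr_left' ⟨fun h u hu ↦ mul_eq_mul_of_coe_mul_eq₈ (h u hu).symm, fun h u hu ↦ (coe_mul_eq_coe_mul_of_mul_eq₈ (h u hu)).symm⟩

/-- Membership form: `g ∈ S(H)(ℚ)` iff `g` commutes with every Hodge automorphism and preserves `Q`. [cite: Milne1999LefschetzClasses, §1 p. 644 L16–L20] -/
theorem Polarization.mem_lefschetzGroup_iff_forall_autGroup_comm (g : V ≃ₗ[ℚ] V) :
    g ∈ ψ.lefschetzGroup ↔ (∀ u ∈ H.autGroup, u * g = g * u) ∧ ∀ v w, ψ.form (g v) (g w) = ψ.form v w := by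
  rw [ψ.lefschetzGroup_eq_centralizer_autGroup_inf_isometryGroup, Subgroup.mem_inf, Subgroup.mem_centralizer_iff]
  rfl

/-- **A Hodge isometry lies in `S(H)(ℚ)` iff it is central in `Aut(V, φ)`** (`Aut(V, Q, φ) ∩ S(H)(ℚ) = Aut(V, Q, φ) ∩ Z(Aut(V, φ))`, the `Q`-unitary central units of `E_φ`).
[cite: Milne1999LefschetzClasses, §1 p. 644 L16–L20 and Remark 1.2 (p. 643)] -/
theorem Polarization.coe_mem_lefschetzGroup_iff_mem_center (g : ψ.autGroup) :
    (g : V ≃ₗ[ℚ] V) ∈ ψ.lefschetzGroup ↔ (⟨g, ψ.autGroup_le_autGroup g.2⟩ : H.autGroup) ∈ Subgroup.center H.autGroup := by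
  rw [ψ.mem_lefschetzGroup_iff_forall_autGroup_comm, Subgroup.mem_center_iff]
  constructor
  · rintro ⟨h, -⟩ u
    exact Subtype.ext (h u u.2)
  · intro h
    exact ⟨fun u hu ↦ congrArg Subtype.val (h ⟨u, hu⟩), g.2.2⟩

/-- **`Aut(V, Q, φ) ≤ S(H)(ℚ)` iff `Aut(V, Q, φ)` is central in `Aut(V, φ)`.** [cite: Milne1999LefschetzClasses, §1 p. 644 L16–L20] -/
theorem Polarization.autGroup_le_lefschetzGroup_iff : ψ.autGroup ≤ ψ.lefschetzGroup ↔ ψ.autGroup.subgroupOf H.autGroup ≤ Subgroup.center H.autGroup := by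
  constructor
  · intro h g hg
    exact (ψ.coe_mem_lefschetzGroup_iff_mem_center ⟨g, Subgroup.mem_subgroupOf.1 hg⟩).1 (h (Subgroup.mem_subgroupOf.1 hg))
  · intro h g hg
    exact (ψ.coe_mem_lefschetzGroup_iff_mem_center ⟨g, hg⟩).2 (h (Subgroup.mem_subgroupOf.2 hg))

variable [HodgeTensorFacts.{u, u}]

/-- **Bicommutant relative to `G(ℚ)`: `Z_{GL(V)}(Z_{G(ℚ)}(Aut(V, φ))) = Aut(V, φ)`** (`Z_{G(ℚ)}(Aut(V, φ)) = S(H)(ℚ)` here, and `Z_{GL(V)}(S(H)(ℚ)) = Aut(V, φ)` — g44-#6, through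
«`C(A)` is generated by `S(A)(k)`» and Remark 1.2). [cite: Milne1999LefschetzClasses, §1 Remark 1.2 (p. 643), p. 644 L16–L20 and §3 p. 653 L44–L45] -/
theorem Polarization.centralizer_centralizer_autGroup_inf_isometryGroup_eq :
    Subgroup.centralizer ((Subgroup.centralizer (H.autGroup : Set (V ≃ₗ[ℚ] V)) ⊓ ψ.isometryGroup : Subgroup (V ≃ₗ[ℚ] V)) : Set (V ≃ₗ[ℚ] V)) = H.autGroup := by
  rw [← ψ.lefschetzGroup_eq_centralizer_autGroup_inf_isometryGroup, ← ψ.autGroup_eq_centralizer_lefschetzGroup]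

/-- **`Z_{G(ℚ)}(Z_{GL(V)}(S(H)(ℚ))) = S(H)(ℚ)`**: Milne's group is its own bicommutant relative to `G(ℚ)`. [cite: Milne1999LefschetzClasses, §1 Remark 1.2 (p. 643), p. 644 L16–L20 and §3 p. 653 L44–L45] -/
theorem Polarization.centralizer_centralizer_lefschetzGroup_inf_isometryGroup_eq :
    Subgroup.centralizer ((Subgroup.centralizer (ψ.lefschetzGroup : Set (V ≃ₗ[ℚ] V)) : Subgroup (V ≃ₗ[ℚ] V)) : Set (V ≃ₗ[ℚ] V)) ⊓ ψ.isometryGroup = ψ.lefschetzGroup := by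
  rw [← ψ.autGroup_eq_centralizer_lefschetzGroup, ← ψ.lefschetzGroup_eq_centralizer_autGroup_inf_isometryGroup]

end Polarized

end HodgeStructure

end Literature.AlgebraicGeometry.Motives
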